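import Mathlib
import HarnessLib
import Summits.HubbardSuperconductivity.HubbardSuperconductivity.Theorems.KLProgrammeH10TwoPointLimitPerturbedCountDeriv
import Summits.HubbardSuperconductivity.HubbardSuperconductivity.Theorems.KLProgrammeH10TwoPointLimitPerturbedFermiRadiusSecondOrder

/-!
# Route `KLProgramme` — crux K1 `H10TwoPointLimit` (stmt-HubbardSuperconductivity-19938):
# the perturbed Fermi curve at second order — the ACCELERATION BOUND (`|u''| ≤ U₂`, uniform in the angle and in `δ`)

Consequence of the twice-differentiated level equation `radial_second_deriv_identity` (`…PerturbedFermiRadiusSecondOrder.lean`) and the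
first-order data at the shifted level (`…PerturbedCountDeriv.lean`): for a root selection `u` of `{ε₀ + δ = μ}` with `δ ∈ C²`, `|δ| ≤ κ₀`,
`‖Dδ‖ ≤ κ₁ < Dt_min`, `‖D(Dδ)‖ ≤ κ₂` on the closed square and `[μ - κ₀, μ + κ₀] ⊂ [a, b]`,

  `|u''(θ)| ≤ ((4 + κ₂) S_E² + (8 + 2κ₁) U₁ + (4 + κ₁) π√2)/(Dt_min - κ₁)`,
  `S_E = s_max + κ₁ (π√2 + 2 s_max)/(Dt_min - κ₁)` (the speed bound `abs_VXE_le`), `U₁ = (4 + κ₁) π√2/(Dt_min - κ₁)` (the slope bound `abs_deriv_le`)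

(`abs_second_deriv_le`) — the `A₂`-type field of the perturbed curve that the counting toolbox's fold analysis consumes (PORT-NOTE (b3)); with it
`|X_E''|, |Y_E''| ≤ U₂ + 2U₁ + π√2` (`abs_accel_le`). Everything is PROVED; no definitions.
References: BGM 2006 §2.4 Lemma 2.1 (2.41) [cite: BenfattoGiulianiMastropietro2006].
-/

noncomputable section

namespace Summit.HubbardSuperconductivity.HubbardSuperconductivity.Theorems.PerturbedFermiCurve

set_option linter.dupNamespace false -- summit = problem name (single-conjunct summit), D-0017

open Real Set
open Literature.MathematicalPhysics.QuantumLattice Literature.MathematicalPhysics.QuantumLattice.BandSectorCounting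

/-- `|∂_t F(θ, t)| ≤ 4`. [folklore] -/
theorem abs_rayDispersionDt_le_four (θ t : ℝ) : |rayDispersionDt θ t| ≤ 4 := by
  unfold rayDispersionDt
  have h1 := Real.abs_cos_le_one θ; have h2 := Real.abs_sin_le_one θ
  have h3 := Real.abs_sin_le_one (t * Real.cos θ); have h4 := Real.abs_sin_le_one (t * Real.sin θ)
  rw [abs_mul, abs_two]
  have : |Real.cos θ * Real.sin (t * Real.cos θ) + Real.sin θ * Real.sin (t * Real.sin θ)| ≤ 2 := by
    refine (abs_add_le _ _).trans ?_
    rw [abs_mul, abs_mul]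
    nlinarith [abs_nonneg (Real.cos θ), abs_nonneg (Real.sin θ), abs_nonneg (Real.sin (t * Real.cos θ)),
      abs_nonneg (Real.sin (t * Real.sin θ))]
  linarith

/-- `|D(Dδ)(k)[v][w]| ≤ κ₂ ‖v‖ ‖w‖`. [folklore] -/
theorem abs_fderiv_fderiv_le {δ : (Fin 2 → ℝ) → ℝ} {k : Fin 2 → ℝ} {κ₂ : ℝ} (hκ₂ : ‖fderiv ℝ (fderiv ℝ δ) k‖ ≤ κ₂)
    (v w : Fin 2 → ℝ) : |fderiv ℝ (fderiv ℝ δ) k v w| ≤ κ₂ * ‖v‖ * ‖w‖ := by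
  rw [← Real.norm_eq_abs]
  refine ((fderiv ℝ (fderiv ℝ δ) k v).le_opNorm w).trans ?_
  refine mul_le_mul_of_nonneg_right ?_ (norm_nonneg _)
  exact ((fderiv ℝ (fderiv ℝ δ) k).le_opNorm v).trans (mul_le_mul_of_nonneg_right hκ₂ (norm_nonneg _))

section Accel

variable {a b : ℝ} (B : BandBounds a b) {δ : (Fin 2 → ℝ) → ℝ} (hδs : ContDiff ℝ 2 δ)
  {κ₀ κ₁ κ₂ μ : ℝ} (hδ : ∀ k : Fin 2 → ℝ, (∀ i, |k i| ≤ π) → |δ k| ≤ κ₀) (hlo : a ≤ μ - κ₀) (hhi : μ + κ₀ ≤ b)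
  (hκ : ∀ k : Fin 2 → ℝ, (∀ i, |k i| ≤ π) → ‖fderiv ℝ δ k‖ ≤ κ₁) (hκ₁ : κ₁ < B.Dtmin)
  (hκ₂ : ∀ k : Fin 2 → ℝ, (∀ i, |k i| ≤ π) → ‖fderiv ℝ (fderiv ℝ δ) k‖ ≤ κ₂)
  {u : ℝ → ℝ} (hu : ∀ θ, IsBandFermiRadius (μ - δ (u θ • dir θ)) θ (u θ))
include B hδs hδ hlo hhi hκ hκ₁ hκ₂ hu

/-- **Acceleration bound on the perturbed curve**: `|u''| ≤ ((4 + κ₂) S_E² + (8 + 2κ₁) U₁ + (4 + κ₁) π√2)/(Dt_min - κ₁)`.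
[cite: BenfattoGiulianiMastropietro2006, §2.4 Lemma 2.1 (2.41)] -/
theorem abs_second_deriv_le (θ : ℝ) :
    |deriv (deriv u) θ| ≤
      ((4 + κ₂) * (B.smax + κ₁ * (π * Real.sqrt 2 + 2 * B.smax) / (B.Dtmin - κ₁)) ^ 2 +
        (8 + 2 * κ₁) * ((4 + κ₁) * (π * Real.sqrt 2) / (B.Dtmin - κ₁)) + (4 + κ₁) * (π * Real.sqrt 2)) / (B.Dtmin - κ₁) := by
  have h2ne : (2 : WithTop ℕ∞) ≠ 0 := by norm_num
  -- the data at `θ`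
  set SE := B.smax + κ₁ * (π * Real.sqrt 2 + 2 * B.smax) / (B.Dtmin - κ₁) with hSE
  set U1 := (4 + κ₁) * (π * Real.sqrt 2) / (B.Dtmin - κ₁) with hU1
  have hsq := abs_apply_le_pi_of_isBandFermiRadius (hu θ)
  have hden : 0 < B.Dtmin - κ₁ := sub_pos.2 hκ₁
  obtain ⟨hvx, hvy⟩ := abs_VXE_le B hδs h2ne hδ hlo hhi hκ hκ₁ hu θ
  have hupos : 0 < u θ := (mem_Ioo_of_shifted B hδ hlo hhi (hu θ)).1
  have hule : u θ ≤ π * Real.sqrt 2 := root_le_pi_mul_sqrt_two B hδ hlo hhi hu θ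
  have hκ₁0 : 0 ≤ κ₁ := le_trans (norm_nonneg _) (hκ _ hsq)
  have hκ₂0 : 0 ≤ κ₂ := (norm_nonneg (fderiv ℝ (fderiv ℝ δ) (u θ • dir θ))).trans (hκ₂ _ hsq)
  have hSE0 : 0 ≤ SE := (abs_nonneg _).trans hvx
  have hu1 : |deriv u θ| ≤ U1 := by
    have h := abs_deriv_le B hδs h2ne hδ hlo hhi hκ hκ₁ hu θ
    refine h.trans ?_
    rw [hU1]
    exact div_le_div_of_nonneg_right (mul_le_mul_of_nonneg_left hule (by linarith)) hden.le
  have hU10 : 0 ≤ U1 := (abs_nonneg _).trans hu1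
  -- the identity
  have hroot : ∀ ϑ, sqDispersion (u ϑ • dir ϑ) + δ (u ϑ • dir ϑ) = μ := fun ϑ =>
    ((isBandFermiRadius_shifted_iff δ μ ϑ (u ϑ)).1 (hu ϑ)).2
  have hu2 : ContDiff ℝ 2 u := contDiff_of_isRoot B hδs h2ne hδ hlo hhi hκ hκ₁ hu
  have hid := radial_second_deriv_identity hδs hu2 hroot θ
  -- names
  set T := rayDispersionDt θ (u θ) with hT
  set Q := fderiv ℝ δ (u θ • dir θ) (dir θ) with hQ
  set Ap := fderiv ℝ δ (u θ • dir θ) (dir (θ + π / 2)) with hAp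
  set D2 := fderiv ℝ (fderiv ℝ δ) (u θ • dir θ) ![VXE u θ, VYE u θ] ![VXE u θ, VYE u θ] with hD2
  have hTQ : B.Dtmin - κ₁ ≤ T + Q := Dtmin_sub_le_pertDt B hδ hlo hhi hκ hu θ
  have hTQpos : 0 < T + Q := hden.trans_le hTQ
  have hT4 : |T| ≤ 4 := abs_rayDispersionDt_le_four θ (u θ)
  have hQ1 : |Q| ≤ κ₁ := abs_fderiv_dir_le (hκ _ hsq) θ
  have hAp1 : |Ap| ≤ κ₁ := abs_fderiv_dir_le (hκ _ hsq) (θ + π / 2)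
  have hv : ‖(![VXE u θ, VYE u θ] : Fin 2 → ℝ)‖ ≤ SE := norm_vec2_le hSE0 hvx hvy
  have hD2b : |D2| ≤ κ₂ * SE ^ 2 := by
    have h := abs_fderiv_fderiv_le (hκ₂ _ hsq) ![VXE u θ, VYE u θ] ![VXE u θ, VYE u θ]
    refine h.trans ?_
    rw [sq, mul_assoc]
    exact mul_le_mul_of_nonneg_left (mul_le_mul hv hv (norm_nonneg _) hSE0) hκ₂0
  -- bound the right-hand side of the identity
  have hcX := Real.abs_cos_le_one (XE u θ); have hcY := Real.abs_cos_le_one (YE u θ)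
  have hsX := Real.abs_sin_le_one (XE u θ); have hsY := Real.abs_sin_le_one (YE u θ)
  have hsθ := Real.abs_sin_le_one θ; have hcθ := Real.abs_cos_le_one θ
  have hVX2 : VXE u θ ^ 2 ≤ SE ^ 2 := by rw [← sq_abs]; exact pow_le_pow_left₀ (abs_nonneg _) hvx 2
  have hVY2 : VYE u θ ^ 2 ≤ SE ^ 2 := by rw [← sq_abs]; exact pow_le_pow_left₀ (abs_nonneg _) hvy 2
  have h1 : |2 * Real.cos (XE u θ) * VXE u θ ^ 2| ≤ 2 * SE ^ 2 := by
    calc |2 * Real.cos (XE u θ) * VXE u θ ^ 2| = 2 * |Real.cos (XE u θ)| * VXE u θ ^ 2 := by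
          rw [abs_mul, abs_mul, abs_two, abs_of_nonneg (sq_nonneg (VXE u θ))]
      _ ≤ 2 * 1 * SE ^ 2 := by gcongr
      _ = 2 * SE ^ 2 := by ring
  have h2 : |2 * Real.cos (YE u θ) * VYE u θ ^ 2| ≤ 2 * SE ^ 2 := by
    calc |2 * Real.cos (YE u θ) * VYE u θ ^ 2| = 2 * |Real.cos (YE u θ)| * VYE u θ ^ 2 := by
          rw [abs_mul, abs_mul, abs_two, abs_of_nonneg (sq_nonneg (VYE u θ))]
      _ ≤ 2 * 1 * SE ^ 2 := by gcongr
      _ = 2 * SE ^ 2 := by ring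
  have h3 : |4 * deriv u θ * (Real.sin (XE u θ) * Real.sin θ - Real.sin (YE u θ) * Real.cos θ)| ≤ 8 * U1 := by
    have hin : |Real.sin (XE u θ) * Real.sin θ - Real.sin (YE u θ) * Real.cos θ| ≤ 2 := by
      refine (abs_sub _ _).trans ?_
      rw [abs_mul, abs_mul]
      have e1 : |Real.sin (XE u θ)| * |Real.sin θ| ≤ 1 * 1 := mul_le_mul hsX hsθ (abs_nonneg _) zero_le_one
      have e2 : |Real.sin (YE u θ)| * |Real.cos θ| ≤ 1 * 1 := mul_le_mul hsY hcθ (abs_nonneg _) zero_le_one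
      linarith
    rw [abs_mul, abs_mul, show |(4:ℝ)| = 4 by norm_num]
    have e : |deriv u θ| * |Real.sin (XE u θ) * Real.sin θ - Real.sin (YE u θ) * Real.cos θ| ≤ U1 * 2 :=
      mul_le_mul hu1 hin (abs_nonneg _) hU10
    linarith
  have h4 : |u θ * T| ≤ 4 * (π * Real.sqrt 2) := by
    rw [abs_mul, abs_of_pos hupos]
    have e : u θ * |T| ≤ (π * Real.sqrt 2) * 4 := mul_le_mul hule hT4 (abs_nonneg _) (by positivity)
    linarith
  have h5 : |2 * deriv u θ * Ap| ≤ 2 * U1 * κ₁ := by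
    rw [abs_mul, abs_mul, abs_two]
    have e : |deriv u θ| * |Ap| ≤ U1 * κ₁ := mul_le_mul hu1 hAp1 (abs_nonneg _) hU10
    linarith
  have h6 : |u θ * Q| ≤ π * Real.sqrt 2 * κ₁ := by
    rw [abs_mul, abs_of_pos hupos]
    exact mul_le_mul hule hQ1 (abs_nonneg _) (by positivity)
  have hR : |(T + Q) * deriv (deriv u) θ| ≤
      (4 + κ₂) * SE ^ 2 + (8 + 2 * κ₁) * U1 + (4 + κ₁) * (π * Real.sqrt 2) := by
    rw [hid]
    have e := abs_add_le (2 * Real.cos (XE u θ) * VXE u θ ^ 2 + 2 * Real.cos (YE u θ) * VYE u θ ^ 2) D2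
    have e' := abs_add_le (2 * Real.cos (XE u θ) * VXE u θ ^ 2) (2 * Real.cos (YE u θ) * VYE u θ ^ 2)
    have := abs_add_le (-(2 * Real.cos (XE u θ) * VXE u θ ^ 2 + 2 * Real.cos (YE u θ) * VYE u θ ^ 2 + D2) +
        4 * deriv u θ * (Real.sin (XE u θ) * Real.sin θ - Real.sin (YE u θ) * Real.cos θ) + u θ * T - 2 * deriv u θ * Ap)
      (u θ * Q)
    have := abs_sub (-(2 * Real.cos (XE u θ) * VXE u θ ^ 2 + 2 * Real.cos (YE u θ) * VYE u θ ^ 2 + D2) +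
        4 * deriv u θ * (Real.sin (XE u θ) * Real.sin θ - Real.sin (YE u θ) * Real.cos θ) + u θ * T) (2 * deriv u θ * Ap)
    have := abs_add_le (-(2 * Real.cos (XE u θ) * VXE u θ ^ 2 + 2 * Real.cos (YE u θ) * VYE u θ ^ 2 + D2) +
        4 * deriv u θ * (Real.sin (XE u θ) * Real.sin θ - Real.sin (YE u θ) * Real.cos θ)) (u θ * T)
    have := abs_add_le (-(2 * Real.cos (XE u θ) * VXE u θ ^ 2 + 2 * Real.cos (YE u θ) * VYE u θ ^ 2 + D2))
        (4 * deriv u θ * (Real.sin (XE u θ) * Real.sin θ - Real.sin (YE u θ) * Real.cos θ))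
    rw [abs_neg] at this
    linarith
  -- divide by `T + Q ≥ Dt_min - κ₁`
  rw [abs_mul, abs_of_pos hTQpos] at hR
  rw [le_div_iff₀ hden]
  have h0 : 0 ≤ |deriv (deriv u) θ| := abs_nonneg _
  calc |deriv (deriv u) θ| * (B.Dtmin - κ₁) ≤ |deriv (deriv u) θ| * (T + Q) := mul_le_mul_of_nonneg_left hTQ h0
    _ = (T + Q) * |deriv (deriv u) θ| := by ring
    _ ≤ _ := hR

end Accel

end Summit.HubbardSuperconductivity.HubbardSuperconductivity.Theorems.PerturbedFermiCurve

end
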